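import Mathlib
import Summits.Ventures.PercRepro2.HCov
import Summits.Ventures.PercRepro2.GcInterior
import Summits.Ventures.PercRepro2.GcHatConn
import Summits.Ventures.PercRepro2.GcHatPush
import Summits.Ventures.PercRepro2.GcHat

/-!
# The hat closure: (HCOV) on the hat graph gives (HCOV) on `G` (blind cell PercRepro2, typer-1 g56)

At interior weights the three pattern masses `N, A, B` of a hat are positive (`masses_pos_of_int`),
so the scale `c = (A + N)(B + N) / N` is positive (`hatC_pos_of_int`) and the hat weights are
admissible (`isProbVec_hatWeights_of_int`); with `Gc = c³ · Gc'` (`Gc_hat`):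

* **`HCov_of_hat`** — (HCOV) on the hat graph under the hat weights gives (HCOV) on `G`;
* **`nonLoopCard_hatGraph_lt`** — the hat graph has one non-loop edge fewer (`e₁` a loop, `e₂, e₃`
  the pattern edges): the hat is one more REDUCTION of the weighted calculus, folded into the
  class of record in `GcSkelReductionHat.lean`.

Standard axioms.
-/

namespace Summit.Ventures.PercRepro2

open CovForm RECM

namespace Hat

section Closure

variable {V : Type*} {E : Type*} [Fintype E] [DecidableEq E] [DecidableEq V] {R : Type*}
  [Field R] [LinearOrder R] [IsStrictOrderedRing R] {ends : E → Sym2 V} {o a₁ a₂ a₃ b u w : V}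
  {e₁ e₂ e₃ : E}

omit [Fintype E] [DecidableEq E] [DecidableEq V] in
/-- At interior weights the three pattern masses are positive. -/
lemma masses_pos_of_int {p : E → R} (hp : IsIntVec p) (e₁ e₂ e₃ : E) :
    0 < hatN p e₁ e₂ e₃ ∧ 0 < hatA p e₁ e₂ e₃ ∧ 0 < hatB p e₁ e₂ e₃ := by
  have h1 := hp.pos e₁
  have h2 := hp.pos e₂
  have h3 := hp.pos e₃
  have h1' := hp.lt_one e₁
  have h2' := hp.lt_one e₂
  have h3' := hp.lt_one e₃
  refine ⟨?_, ?_, ?_⟩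
  · unfold hatN
    have : 0 < (1 - p e₃) * (1 - p e₁ * p e₂) :=
      mul_pos (sub_pos.2 h3') (sub_pos.2 (mul_lt_one_of_nonneg_of_lt_one_left h1.le h1' h2'.le))
    have : 0 < p e₃ * (1 - p e₁) * (1 - p e₂) :=
      mul_pos (mul_pos h3 (sub_pos.2 h1')) (sub_pos.2 h2')
    linarith
  · unfold hatA
    exact mul_pos (mul_pos h1 (sub_pos.2 h2')) h3
  · unfold hatB
    exact mul_pos (mul_pos (sub_pos.2 h1') h2) h3

omit [Fintype E] [DecidableEq E] [DecidableEq V] in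
/-- At interior weights the scale is positive. -/
lemma hatC_pos_of_int {p : E → R} (hp : IsIntVec p) (e₁ e₂ e₃ : E) : 0 < hatC p e₁ e₂ e₃ := by
  obtain ⟨hN, hA, hB⟩ := masses_pos_of_int hp e₁ e₂ e₃
  unfold hatC
  exact div_pos (mul_pos (by linarith) (by linarith)) hN

omit [Fintype E] [DecidableEq V] in
/-- At interior weights the hat weights are admissible. -/
lemma isProbVec_hatWeights_of_int {p : E → R} (hp : IsIntVec p) (e₁ e₂ e₃ : E) :
    IsProbVec (hatWeights p e₁ e₂ e₃) := by
  obtain ⟨hN, hA, hB⟩ := masses_pos_of_int hp e₁ e₂ e₃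
  have hq1 : 0 ≤ hatQ1 p e₁ e₂ e₃ ∧ hatQ1 p e₁ e₂ e₃ ≤ 1 := by
    unfold hatQ1
    exact ⟨div_nonneg hA.le (by linarith), div_le_one_of_le₀ (by linarith) (by linarith)⟩
  have hq2 : 0 ≤ hatQ2 p e₁ e₂ e₃ ∧ hatQ2 p e₁ e₂ e₃ ≤ 1 := by
    unfold hatQ2
    exact ⟨div_nonneg hB.le (by linarith), div_le_one_of_le₀ (by linarith) (by linarith)⟩
  have hp' := hp.isProbVec
  refine ⟨fun e => ?_, fun e => ?_⟩
  · unfold hatWeights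
    by_cases h3 : e = e₃
    · rw [h3, Function.update_self]; exact hq1.1
    rw [Function.update_of_ne h3]
    by_cases h2 : e = e₂
    · rw [h2, Function.update_self]; exact hq2.1
    rw [Function.update_of_ne h2]
    by_cases h1 : e = e₁
    · rw [h1, Function.update_self]
    rw [Function.update_of_ne h1]
    exact hp'.nonneg e
  · unfold hatWeights
    by_cases h3 : e = e₃
    · rw [h3, Function.update_self]; exact hq1.2
    rw [Function.update_of_ne h3]
    by_cases h2 : e = e₂
    · rw [h2, Function.update_self]; exact hq2.2
    rw [Function.update_of_ne h2]
    by_cases h1 : e = e₁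
    · rw [h1, Function.update_self]; exact zero_le_one
    rw [Function.update_of_ne h1]
    exact hp'.le_one e

omit [LinearOrder R] [IsStrictOrderedRing R] in
/-- **The hat graph has one non-loop edge fewer**: `e₁` became a loop, `e₂, e₃` stay non-loops. -/
lemma nonLoopCard_hatGraph_lt (h : IsHatAt ends u a₁ a₂ w e₁ e₂ e₃) :
    nonLoopCard (hatGraph ends a₁ a₂ w e₁ e₂ e₃) < nonLoopCard ends := by
  unfold nonLoopCard
  apply Finset.card_lt_card
  have hsub : (Finset.univ.filter fun f => ¬ (hatGraph ends a₁ a₂ w e₁ e₂ e₃ f).IsDiag) ⊆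
      Finset.univ.filter fun f => ¬ (ends f).IsDiag := by
    intro f hf
    simp only [Finset.mem_filter, Finset.mem_univ, true_and] at hf ⊢
    by_cases f1 : f = e₁
    · exact absurd (by rw [f1, hatGraph_e1 h]; simp) hf
    by_cases f2 : f = e₂
    · rw [f2, h.h2, Sym2.mk_isDiag_iff]; exact h.ua2.symm
    by_cases f3 : f = e₃
    · rw [f3, h.h3, Sym2.mk_isDiag_iff]; exact h.uw.symm
    rwa [hatGraph_of_ne f1 f2 f3] at hf
  rw [Finset.ssubset_iff_of_subset hsub]
  refine ⟨e₁, ?_, ?_⟩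
  · simp only [Finset.mem_filter, Finset.mem_univ, true_and]
    rw [h.h1, Sym2.mk_isDiag_iff]; exact h.ua1.symm
  · simp [hatGraph_e1 h]

/-- **THE HAT CLOSURE**: at interior weights, (HCOV) on the hat graph under the hat weights gives
(HCOV) on `G`. -/
theorem HCov_of_hat {p : E → R} (hp : IsIntVec p) (h : IsHatAt ends u a₁ a₂ w e₁ e₂ e₃)
    (huo : o ≠ u) (hu3 : a₃ ≠ u) (hub : b ≠ u)
    (H : HCov (hatWeights p e₁ e₂ e₃) (hatGraph ends a₁ a₂ w e₁ e₂ e₃) o a₁ a₂ a₃ b) :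
    HCov p ends o a₁ a₂ a₃ b := by
  obtain ⟨hN, hA, hB⟩ := masses_pos_of_int hp e₁ e₂ e₃
  unfold HCov at H ⊢
  rw [Gc_hat h p hN.ne' (by linarith) (by linarith) huo hu3 hub]
  exact mul_nonneg (pow_nonneg (hatC_pos_of_int hp e₁ e₂ e₃).le 3) H

end Closure

end Hat

end Summit.Ventures.PercRepro2
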